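import Literature.NumberTheory.Sieve.FGKMT2018ConditionalLaw
import HarnessLib

/-!
# Ford–Green–Konyagin–Maynard–Tao 2018 — §6: deterministic reductions for the deduction of
# Theorem 4 from Theorem 5 (PROVED)

Topic `Literature/NumberTheory/Sieve`. Source: K. Ford, B. Green, S. Konyagin, J. Maynard, T. Tao,
*Long gaps between primes*, J. Amer. Math. Soc. 31 (2018) 65–105 = arXiv:1412.5029, §6 pp. 17–19
[FordGreenKonyaginMaynardTao2018]: «We can now deduce Theorem 4 from Theorem 5 … It is clear that
Theorem 2 (with (4.5), (4.6) and (4.7)) follows from Lemmas 6.2 and 6.3 [p. 18] … Observe from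
(6.12) that we have `Σ_{p ∈ 𝒫} P(q ∈ e_p(a⃗) | a⃗ = a⃗) = Σ_{p ∈ 𝒫(a⃗)} X_p(a⃗)^{-1} Σ_i Z_p(a⃗; q − h_i p)`
[p. 18] … We first show that replacing `X_p(a⃗)` with `σ^r` has negligible effect … Next, we show
that the set 𝒫(a⃗) may be replaced with 𝒫 with negligible effect … By Markov's inequality …
except with probability `O(log^{-1/2} x)` [p. 19]».

This file PROVES the deterministic and elementary-probability glue of that deduction, so that the
remaining kernel target (Theorem 5 ⇒ Theorem 4′, edge [d]) is the instantiation of the engines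
`FGKMT2018BoxMoments` (Lemma 6.1/Cor 4), `FGKMT2018GoodPrimes` (Lemma 6.3), `FGKMT2018CoveringMoments`
(Lemma 6.2) with the data of Theorem 5:
* `boxExp_boole`, `boxExp_bad_part_le` — `E[F 1_{bad}] ≤ U − L(1 − β)` («replacing 𝒫(a⃗) with 𝒫»,
  the expectation behind (6.15));
* `exists_good_of_markov3` — three Markov inequalities and a union bound on the finite box give a
  good `a⃗` (the paper's «with probability 1 − o(1)» steps, made effective);
* `sum_Zp_shift_le` — `Σ_{q} Σ_h Σ_{p ∈ P'} Z_p(a⃗; q − hp) ≤ r Σ_{p ∈ P'} X_p(a⃗)` (the left side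
  of (6.15) rearranged);
* `covering_sum_estimate` — from `|σ^{-r} Σ_i Σ_p Z_p − C| ≤ κ`, the bad-prime part `≤ κ'` and
  `X_p = (1 + O_≤(η)) σ^r` on 𝒫(a⃗) to `|Σ_p P(q ∈ e_p) − C| ≤ κ + κ' + 2η(C + κ)` ((4.7′));
* `cross_prime_of_lt` — the cross-prime hypothesis of `FGKMT2018CoveringMoments` for primes
  `p > B ≥ |h − h'|`.
-/

noncomputable section

open Finset

namespace Literature.NumberTheory.Sieve

namespace FGKMT2018

/-! ### Elementary probability on the residue box -/

/-- `E 1_A = #A/∏ s`. [cite: FordGreenKonyaginMaynardTao2018, §6 p. 17 (uniform `a⃗`)] -/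
theorem boxExp_boole (S : Finset ℕ) (A : ((s : ℕ) → s ∈ S → ℕ) → Prop) [DecidablePred A] :
    boxExp S (fun f => if A f then 1 else 0) = #((residueBox S).filter A) / ∏ s ∈ S, (s : ℝ) := by
  unfold boxExp
  rw [Finset.sum_boole]

/-- **`E[F · 1_{bad}] ≤ U − L (1 − β)`** for `F` with `E F ≤ U`, `F ≥ L ≥ 0` on the good `a⃗`, and
a bad set of measure `≤ β` — the expectation estimate behind (6.15) («replacing 𝒫(a⃗) with 𝒫»:
`E[σ^{-r} X_p 1_{p ∉ 𝒫(a⃗)}] = E[σ^{-r} X_p] − E[σ^{-r} X_p 1_{p ∈ 𝒫(a⃗)}] ≤ U − (1 − η) P(p ∈ 𝒫(a⃗))`).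
[cite: FordGreenKonyaginMaynardTao2018, Lemma 6.2 (proof) p. 19] -/
theorem boxExp_bad_part_le {S : Finset ℕ} (hS : ∀ s ∈ S, 0 < s)
    {F : ((s : ℕ) → s ∈ S → ℕ) → ℝ} (good : ((s : ℕ) → s ∈ S → ℕ) → Prop) [DecidablePred good]
    {U L β : ℝ} (hU : boxExp S F ≤ U) (hL0 : 0 ≤ L)
    (hgood : ∀ f ∈ residueBox S, good f → L ≤ F f)
    (hβ : (#((residueBox S).filter fun f => ¬ good f) : ℝ) ≤ β * ∏ s ∈ S, (s : ℝ)) :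
    boxExp S (fun f => if good f then 0 else F f) ≤ U - L * (1 - β) := by
  have hPi := prod_moduli_pos hS
  have hsplit : boxExp S (fun f => if good f then 0 else F f) =
      boxExp S F - boxExp S (fun f => if good f then F f else 0) := by
    rw [← boxExp_sub]
    congr 1
    funext f
    split_ifs <;> ring
  have hgoodE : L * (1 - β) ≤ boxExp S (fun f => if good f then F f else 0) := by
    have h1 : boxExp S (fun f => L * if good f then 1 else 0) ≤
        boxExp S (fun f => if good f then F f else 0) := by
      refine boxExp_mono S fun f hf => ?_
      split_ifs with h
      · rw [mul_one]; exact hgood f hf h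
      · rw [mul_zero]
    rw [boxExp_const_mul, boxExp_boole] at h1
    refine le_trans (mul_le_mul_of_nonneg_left ?_ hL0) h1
    -- 1 - β ≤ #good/Π
    rw [le_div_iff₀ hPi]
    have hcard := Finset.card_filter_add_card_filter_not (s := residueBox S) good
    have hcast : (#((residueBox S).filter good) : ℝ) =
        ∏ s ∈ S, (s : ℝ) - #((residueBox S).filter fun f => ¬ good f) := by
      rw [← card_residueBox_cast S, ← hcard]
      push_cast
      ring
    rw [hcast]
    nlinarith
  rw [hsplit]
  linarith

/-- **Three Markov inequalities + union bound on the box**: if `Σ_i E F_i/t_i < 1` for nonnegative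
`F₁, F₂, F₃`, some `a⃗` has `F_i(a⃗) < t_i` for all three `i` (the «with probability `1 − o(1)`»
steps of the deduction, p. 18: (4.5) lower/upper, Lemma 6.2, Lemma 6.3).
[cite: FordGreenKonyaginMaynardTao2018, §6 p. 18] -/
theorem exists_good_of_markov3 {S : Finset ℕ} (hS : ∀ s ∈ S, 0 < s)
    {F₁ F₂ F₃ : ((s : ℕ) → s ∈ S → ℕ) → ℝ} (h₁ : ∀ f ∈ residueBox S, 0 ≤ F₁ f)
    (h₂ : ∀ f ∈ residueBox S, 0 ≤ F₂ f) (h₃ : ∀ f ∈ residueBox S, 0 ≤ F₃ f) {t₁ t₂ t₃ : ℝ}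
    (ht₁ : 0 < t₁) (ht₂ : 0 < t₂) (ht₃ : 0 < t₃)
    (hsum : boxExp S F₁ / t₁ + boxExp S F₂ / t₂ + boxExp S F₃ / t₃ < 1) :
    ∃ f ∈ residueBox S, F₁ f < t₁ ∧ F₂ f < t₂ ∧ F₃ f < t₃ := by
  classical
  have hPi := prod_moduli_pos hS
  have c₁ := card_box_filter_le hS F₁ h₁ ht₁
  have c₂ := card_box_filter_le hS F₂ h₂ ht₂
  have c₃ := card_box_filter_le hS F₃ h₃ ht₃
  set B₁ := (residueBox S).filter fun f => t₁ ≤ F₁ f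
  set B₂ := (residueBox S).filter fun f => t₂ ≤ F₂ f
  set B₃ := (residueBox S).filter fun f => t₃ ≤ F₃ f
  have hlt : (#(B₁ ∪ B₂ ∪ B₃) : ℝ) < #(residueBox S) := by
    calc (#(B₁ ∪ B₂ ∪ B₃) : ℝ) ≤ #B₁ + #B₂ + #B₃ := by
          have := Finset.card_union_le (B₁ ∪ B₂) B₃
          have := Finset.card_union_le B₁ B₂
          exact_mod_cast (by omega : #(B₁ ∪ B₂ ∪ B₃) ≤ #B₁ + #B₂ + #B₃)
      _ ≤ (boxExp S F₁ / t₁ + boxExp S F₂ / t₂ + boxExp S F₃ / t₃) * ∏ s ∈ S, (s : ℝ) := by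
          linarith
      _ < 1 * ∏ s ∈ S, (s : ℝ) := mul_lt_mul_of_pos_right hsum hPi
      _ = #(residueBox S) := by rw [one_mul, card_residueBox_cast]
  have hlt' : #(B₁ ∪ B₂ ∪ B₃) < #(residueBox S) := by exact_mod_cast hlt
  by_contra hne
  push Not at hne
  have hsub : residueBox S ⊆ B₁ ∪ B₂ ∪ B₃ := by
    intro f hf
    rw [Finset.mem_union, Finset.mem_union]
    by_cases g₁ : F₁ f < t₁
    · by_cases g₂ : F₂ f < t₂
      · have g₃ := hne f hf g₁ g₂
        exact Or.inr (Finset.mem_filter.2 ⟨hf, g₃⟩)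
      · exact Or.inl (Or.inr (Finset.mem_filter.2 ⟨hf, not_lt.1 g₂⟩))
    · exact Or.inl (Or.inl (Finset.mem_filter.2 ⟨hf, not_lt.1 g₁⟩))
  exact absurd (Finset.card_le_card hsub) (not_le.2 hlt')

/-! ### The bad-prime part of the covering sum: (6.15), deterministic rearrangement -/

variable {x : ℕ} {a : ℕ → ℕ} {H : Finset ℤ} {w : ℕ → ℤ → ℝ} {N : Finset ℤ} {X₀ η : ℝ}

/-- `Z_p(a⃗; n) = 0` outside the support window `N` of `w(p, ·)`.
[cite: FordGreenKonyaginMaynardTao2018, (6.12) p. 18] -/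
theorem Zp_eq_zero_of_not_mem (hw : ∀ p n, 0 ≤ w p n) (hwN : ∀ p n, n ∉ N → w p n = 0)
    (p : ℕ) {n : ℤ} (hn : n ∉ N) : Zp x a H w N p n = 0 :=
  le_antisymm ((Zp_le_lawTilde hw p n).trans (lawTilde_eq_zero (hwN p n hn)).le) (Zp_nonneg hw p n)

/-- For fixed `p, h`: `Σ_{q ∈ Q'} Z_p(a⃗; q − hp) ≤ Σ_n Z_p(a⃗; n) = X_p(a⃗)` (translation is injective,
`Z_p` vanishes off `N`). [cite: FordGreenKonyaginMaynardTao2018, Lemma 6.2 (proof) p. 19] -/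
theorem sum_Zp_translate_le (hw : ∀ p n, 0 ≤ w p n) (hwN : ∀ p n, n ∉ N → w p n = 0)
    (Q' : Finset ℤ) (p : ℕ) (h : ℤ) :
    ∑ q ∈ Q', Zp x a H w N p (q - h * (p : ℤ)) ≤ Xp x a H w N p := by
  classical
  have hinj : Set.InjOn (fun q : ℤ => q - h * (p : ℤ)) Q' := fun q _ q' _ hqq' => by
    simpa using hqq'
  rw [← Finset.sum_image hinj, Xp]
  rw [← Finset.sum_filter_ne_zero (Q'.image fun q : ℤ => q - h * (p : ℤ))]
  refine Finset.sum_le_sum_of_subset_of_nonneg ?_ fun n _ _ => Zp_nonneg hw p n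
  intro n hn
  rw [Finset.mem_filter] at hn
  by_contra hnN
  exact hn.2 (Zp_eq_zero_of_not_mem hw hwN p hnN)

/-- **`Σ_{q ∈ Q'} Σ_{h ∈ H} Σ_{p ∈ P'} Z_p(a⃗; q − hp) ≤ r · Σ_{p ∈ P'} X_p(a⃗)`** — with `P' = 𝒫 ∖ 𝒫(a⃗)`
this is the left side of (6.15) bounded by the quantity whose expectation is `O(η |𝒫|)`.
[cite: FordGreenKonyaginMaynardTao2018, (6.15) p. 19] -/
theorem sum_Zp_shift_le (hw : ∀ p n, 0 ≤ w p n) (hwN : ∀ p n, n ∉ N → w p n = 0)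
    (Q' : Finset ℤ) (P' : Finset ℕ) :
    ∑ q ∈ Q', ∑ h ∈ H, ∑ p ∈ P', Zp x a H w N p (q - h * (p : ℤ)) ≤
      #H * ∑ p ∈ P', Xp x a H w N p := by
  rw [Finset.sum_comm]
  have hswap : ∑ h ∈ H, ∑ q ∈ Q', ∑ p ∈ P', Zp x a H w N p (q - h * (p : ℤ)) =
      ∑ h ∈ H, ∑ p ∈ P', ∑ q ∈ Q', Zp x a H w N p (q - h * (p : ℤ)) :=
    Finset.sum_congr rfl fun h _ => Finset.sum_comm
  rw [hswap]
  calc ∑ h ∈ H, ∑ p ∈ P', ∑ q ∈ Q', Zp x a H w N p (q - h * (p : ℤ))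
        ≤ ∑ h ∈ H, ∑ p ∈ P', Xp x a H w N p :=
          Finset.sum_le_sum fun h _ => Finset.sum_le_sum fun p _ =>
            sum_Zp_translate_le hw hwN Q' p h
    _ = #H * ∑ p ∈ P', Xp x a H w N p := by rw [Finset.sum_const, nsmul_eq_mul]

/-! ### From (6.14)–(6.15) to (4.7′): the covering sum at a good `q` -/

/-- The numerator `Σ_h Z_p(a⃗; q − hp)` is nonnegative. [cite: FordGreenKonyaginMaynardTao2018, (6.12) p. 18] -/
theorem sum_Zp_nonneg (hw : ∀ p n, 0 ≤ w p n) (p : ℕ) (q : ℤ) :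
    0 ≤ ∑ h ∈ H, Zp x a H w N p (q - h * (p : ℤ)) :=
  Finset.sum_nonneg fun _ _ => Zp_nonneg hw p _

/-- Splitting `Σ_{p ∈ 𝒫} = Σ_{p ∈ 𝒫(a⃗)} + Σ_{p ∈ 𝒫 ∖ 𝒫(a⃗)}`.
[cite: FordGreenKonyaginMaynardTao2018, Lemma 6.2 (proof) p. 19] -/
theorem sum_primesHalf_split (F : ℕ → ℝ) :
    ∑ p ∈ primesHalf x, F p = ∑ p ∈ goodPrimes x a H w N X₀ η, F p +
      ∑ p ∈ (primesHalf x).filter (fun p => p ∉ goodPrimes x a H w N X₀ η), F p := by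
  classical
  rw [← Finset.sum_filter_add_sum_filter_not (primesHalf x)
    (fun p => p ∈ goodPrimes x a H w N X₀ η)]
  congr 1
  refine Finset.sum_congr ?_ fun _ _ => rfl
  ext p
  simp only [Finset.mem_filter]
  exact ⟨fun h => h.2, fun h => ⟨goodPrimes_subset h, h⟩⟩

/-- **(4.7′) from (6.14)–(6.15)**: let `q ∈ 𝒬 ∩ S(a⃗)`, `0 < X₀` (`= σ^r`), `0 ≤ η ≤ 1/2`. If
`|X₀^{-1} Σ_h Σ_{p ∈ 𝒫} Z_p(a⃗; q − hp) − C| ≤ κ` ((6.14)) and the bad-prime part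
`X₀^{-1} Σ_h Σ_{p ∈ 𝒫 ∖ 𝒫(a⃗)} Z_p(a⃗; q − hp) ≤ κ'` ((6.15)), then
`|Σ_{p ∈ 𝒫} P(q ∈ e_p(a⃗)) − C| ≤ κ + κ' + 2η (C + κ)` (with the conditional laws (6.12)).
[cite: FordGreenKonyaginMaynardTao2018, §6 pp. 18–19] -/
theorem covering_sum_estimate {c : ℝ} (hw : ∀ p n, 0 ≤ w p n)
    (hwN : ∀ p n, n ∉ N → w p n = 0) (h0 : (0 : ℤ) ∈ N) (hX₀ : 0 < X₀) (hη0 : 0 ≤ η)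
    (hη : η ≤ 1 / 2) {q : ℕ} (hq : q ∈ sievedQ c x a) {C κ κ' : ℝ}
    (hY : |(∑ h ∈ H, ∑ p ∈ primesHalf x, Zp x a H w N p ((q : ℤ) - h * (p : ℤ))) / X₀ - C| ≤ κ)
    (hY'' : (∑ h ∈ H, ∑ p ∈ (primesHalf x).filter (fun p => p ∉ goodPrimes x a H w N X₀ η),
        Zp x a H w N p ((q : ℤ) - h * (p : ℤ))) / X₀ ≤ κ') :
    |∑ p ∈ primesHalf x, probInEdge c x a H N (condLaw x a H w N X₀ η) p q - C| ≤
      κ + κ' + 2 * η * (C + κ) := by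
  classical
  rw [sum_probInEdge_condLaw hw hwN h0 hq]
  have hNp0 : ∀ p, 0 ≤ ∑ h ∈ H, Zp x a H w N p ((q : ℤ) - h * (p : ℤ)) :=
    fun p => sum_Zp_nonneg hw p _
  -- y = y' + y''
  obtain ⟨y', hy'def⟩ : ∃ y' : ℝ, y' = (∑ p ∈ goodPrimes x a H w N X₀ η,
      ∑ h ∈ H, Zp x a H w N p ((q : ℤ) - h * (p : ℤ))) / X₀ := ⟨_, rfl⟩
  obtain ⟨y'', hy''def⟩ : ∃ y'' : ℝ, y'' =
      (∑ p ∈ (primesHalf x).filter (fun p => p ∉ goodPrimes x a H w N X₀ η),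
        ∑ h ∈ H, Zp x a H w N p ((q : ℤ) - h * (p : ℤ))) / X₀ := ⟨_, rfl⟩
  have hYsplit : (∑ h ∈ H, ∑ p ∈ primesHalf x, Zp x a H w N p ((q : ℤ) - h * (p : ℤ))) / X₀ =
      y' + y'' := by
    rw [Finset.sum_comm, sum_primesHalf_split (X₀ := X₀) (η := η)
      (fun p => ∑ h ∈ H, Zp x a H w N p ((q : ℤ) - h * (p : ℤ))), add_div, hy'def, hy''def]
  have hY''eq : (∑ h ∈ H, ∑ p ∈ (primesHalf x).filter (fun p => p ∉ goodPrimes x a H w N X₀ η),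
      Zp x a H w N p ((q : ℤ) - h * (p : ℤ))) / X₀ = y'' := by
    rw [Finset.sum_comm, hy''def]
  rw [hYsplit] at hY
  rw [hY''eq] at hY''
  have hy''0 : 0 ≤ y'' := by
    rw [hy''def]; exact div_nonneg (Finset.sum_nonneg fun p _ => hNp0 p) hX₀.le
  have hy'0 : 0 ≤ y' := by
    rw [hy'def]; exact div_nonneg (Finset.sum_nonneg fun p _ => hNp0 p) hX₀.le
  rw [abs_le] at hY
  have hy'lo : C - κ - κ' ≤ y' := by linarith [hY.1]
  have hy'up : y' ≤ C + κ := by linarith [hY.2]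
  -- the sum over good primes is squeezed between y'/(1+η) and y'/(1-η)
  have h1η : 0 < 1 - η := by linarith
  have hterm : ∀ p ∈ goodPrimes x a H w N X₀ η,
      (∑ h ∈ H, Zp x a H w N p ((q : ℤ) - h * (p : ℤ))) / ((1 + η) * X₀) ≤
        (∑ h ∈ H, Zp x a H w N p ((q : ℤ) - h * (p : ℤ))) / Xp x a H w N p ∧
      (∑ h ∈ H, Zp x a H w N p ((q : ℤ) - h * (p : ℤ))) / Xp x a H w N p ≤
        (∑ h ∈ H, Zp x a H w N p ((q : ℤ) - h * (p : ℤ))) / ((1 - η) * X₀) := by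
    intro p hp
    have hXp := (mem_goodPrimes.1 hp).2
    rw [abs_le] at hXp
    have hXlo : (1 - η) * X₀ ≤ Xp x a H w N p := by linarith
    have hXhi : Xp x a H w N p ≤ (1 + η) * X₀ := by linarith
    have hXpos : 0 < Xp x a H w N p := lt_of_lt_of_le (mul_pos h1η hX₀) hXlo
    exact ⟨div_le_div_of_nonneg_left (hNp0 p) hXpos hXhi,
      div_le_div_of_nonneg_left (hNp0 p) (mul_pos h1η hX₀) hXlo⟩
  have hlo : y' / (1 + η) ≤ ∑ p ∈ goodPrimes x a H w N X₀ η,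
      (∑ h ∈ H, Zp x a H w N p ((q : ℤ) - h * (p : ℤ))) / Xp x a H w N p := by
    calc y' / (1 + η) = ∑ p ∈ goodPrimes x a H w N X₀ η,
          (∑ h ∈ H, Zp x a H w N p ((q : ℤ) - h * (p : ℤ))) / ((1 + η) * X₀) := by
          rw [hy'def, div_div, Finset.sum_div, mul_comm]
      _ ≤ _ := Finset.sum_le_sum fun p hp => (hterm p hp).1
  have hhi : ∑ p ∈ goodPrimes x a H w N X₀ η,
      (∑ h ∈ H, Zp x a H w N p ((q : ℤ) - h * (p : ℤ))) / Xp x a H w N p ≤ y' / (1 - η) := by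
    calc ∑ p ∈ goodPrimes x a H w N X₀ η,
          (∑ h ∈ H, Zp x a H w N p ((q : ℤ) - h * (p : ℤ))) / Xp x a H w N p
          ≤ ∑ p ∈ goodPrimes x a H w N X₀ η,
            (∑ h ∈ H, Zp x a H w N p ((q : ℤ) - h * (p : ℤ))) / ((1 - η) * X₀) :=
          Finset.sum_le_sum fun p hp => (hterm p hp).2
      _ = y' / (1 - η) := by rw [hy'def, div_div, Finset.sum_div, mul_comm]
  -- elementary: y'/(1+η) ≥ y' - 2ηy', y'/(1-η) ≤ y' + 2ηy' (0 ≤ η ≤ 1/2)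
  have hηy' : 0 ≤ η * y' := mul_nonneg hη0 hy'0
  have hlo' : y' - 2 * η * y' ≤ y' / (1 + η) := by
    rw [le_div_iff₀ (by linarith)]
    have : (y' - 2 * η * y') * (1 + η) = y' - η * y' - 2 * η * (η * y') := by ring
    rw [this]
    nlinarith
  have hhi' : y' / (1 - η) ≤ y' + 2 * η * y' := by
    rw [div_le_iff₀ h1η]
    have : (y' + 2 * η * y') * (1 - η) = y' + (η * y') * (1 - 2 * η) := by ring
    rw [this]
    nlinarith
  have hηy : 2 * η * y' ≤ 2 * η * (C + κ) := by nlinarith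
  rw [abs_le]
  constructor <;> linarith

/-! ### The cross-prime hypothesis -/

/-- If `p₁ ≠ p₂` are primes exceeding `B` and all differences of elements of `H` are at most `B` in
absolute value, then `(h₁' − h₁) p₁ = (h₂' − h₂) p₂` forces `h₁' = h₁` (hypothesis `hcross` of
`FGKMT2018CoveringMoments`; in §6, `|h − h'| ≤ 2r² ≤ 2 log^{2/5} x < x/2 < p`).
[cite: FordGreenKonyaginMaynardTao2018, Lemma 6.2 (proof) p. 19] -/
theorem cross_prime_of_lt {P : Finset ℕ} (hP : ∀ p ∈ P, p.Prime) {B : ℤ} (hB : ∀ p ∈ P, B < p)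
    {H : Finset ℤ} (hH : ∀ h ∈ H, ∀ h' ∈ H, |h' - h| ≤ B) :
    ∀ p₁ ∈ P, ∀ p₂ ∈ P, p₁ ≠ p₂ → ∀ h₁ ∈ H, ∀ h₁' ∈ H, ∀ h₂ ∈ H, ∀ h₂' ∈ H,
      (h₁' - h₁) * (p₁ : ℤ) = (h₂' - h₂) * (p₂ : ℤ) → h₁' = h₁ := by
  intro p₁ hp₁ p₂ hp₂ hne h₁ hh₁ h₁' hh₁' h₂ hh₂ h₂' hh₂' heq
  have hprime₂ : Prime (p₂ : ℤ) := Nat.prime_iff_prime_int.1 (hP p₂ hp₂)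
  have hdvd : (p₂ : ℤ) ∣ (h₁' - h₁) * (p₁ : ℤ) := ⟨h₂' - h₂, by rw [heq]; ring⟩
  rcases hprime₂.dvd_or_dvd hdvd with hd | hd
  · have hlt : |h₁' - h₁| < (p₂ : ℤ) := lt_of_le_of_lt (hH h₁ hh₁ h₁' hh₁') (hB p₂ hp₂)
    have h0 := Int.eq_zero_of_abs_lt_dvd hd hlt
    linarith
  · exfalso
    have hd' : p₂ ∣ p₁ := by exact_mod_cast hd
    exact hne ((Nat.prime_dvd_prime_iff_eq (hP p₂ hp₂) (hP p₁ hp₁)).1 hd').symm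

/-- The difference bound for `H ⊆ [1, 2r²]`: `|h' − h| ≤ 2r² − 1`.
[cite: FordGreenKonyaginMaynardTao2018, Thm 5 p. 17] -/
theorem abs_sub_le_of_mem_Icc {H : Finset ℤ} (hH : ∀ h ∈ H, 1 ≤ h ∧ h ≤ 2 * (#H : ℤ) ^ 2)
    {h h' : ℤ} (hh : h ∈ H) (hh' : h' ∈ H) : |h' - h| ≤ 2 * (#H : ℤ) ^ 2 - 1 := by
  have h1 := hH h hh
  have h2 := hH h' hh'
  rw [abs_le]
  constructor <;> linarith

end FGKMT2018

end Literature.NumberTheory.Sieve
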